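import Summits.CriticalPhenomena.PercolationContinuityZ3.Theorems.PercNearOneGluingNoHeavyLowerTailKernelCorners
import HarnessLib

/-!
# `NoHeavyLowerTail` (stmt-CriticalPhenomena-4575) — corners of the `2+2` kernel in forced-star coordinates (II):
# the MIXED corner (one unit at a sure hair, the other all-or-nothing) and the FORMAL×FORMAL corner

Support file (lemma factory `prim-lf-3` gen 7, seat g9; `--supports stmt-CriticalPhenomena-4575`).  No definitions, no
named facts, no sorries.  Memo: `run/shared/lean/prim/prim-lf-3/LF3-BETA-R.md` §3–4, §8.

Conventions as in `…KernelCorners.lean`: core `K` with `o` isolated, `Gf(T)` the forced-star margin (abstract `G`, hypothesis `hG`), ports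
`p₁,p₂` (pair `e_P`) of the first unit and `q₁,q₂` (pair `e_Q`) of the second; `KP := K[e_P ↦ 1]`, `KQ`, `KPQ := (f ↦ if f = e_P then 1 else if f = e_Q then 1 else K f)`;
split row of a port `z`: `0 ≤ (1−u)(1−v)(z−j)_K + u(1−v)(z−j)_{KP} + (1−u)v(z−j)_{KQ} + uv(z−j)_{KPQ}`.
* `mixedCorner` — from the row of `q₁`:  `(1−u)[(1−v)Gf{q₁} + v Gf{q₁,q₂}] + u[(1−v)Gf{q₁,p₁,p₂} + v Gf{q₂,q₁,p₁,p₂}] ≥ 0`  (`twoAtomGlue` on the base `K` with `e_Q`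
  raised by `v`, then `real_raisePair_eq_mix` and `forcedMargin_eq`).
* `ffCorner` — from the four rows:  `u(1−v)Gf{p₁,p₂} + (1−u)v Gf{q₁,q₂} + uv Gf{q₂,q₁,p₁,p₂} ≥ 0`  (`twoFormalUnits`; its far-end rows `M_P, M_Q` are obtained from the
  rows of `p₁`, `q₁` by `pairGlue_le` in the base with both pairs raised).
-/

namespace Summit.CriticalPhenomena.PercolationContinuityZ3.Theorems

open MeasureTheory Set ProbabilityTheory
open Literature.Probability.LatticeModels
open Literature.Probability.Percolation

noncomputable section
open Classical

namespace UpsetExchange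

variable {n : ℕ}

/-- **The MIXED corner.**  See the module docstring. [cite: KozmaNitzan2024, Lemma 5 (p. 13), Question 9 (p. 36)] -/
theorem mixedCorner (K : Sym2 (Fin n) → unitInterval) (o p₁ p₂ q₁ q₂ j b : Fin n) (u v : unitInterval)
    (hp : p₁ ≠ p₂) (hq : q₁ ≠ q₂) (h11 : p₁ ≠ q₁) (h12 : p₁ ≠ q₂) (h21 : p₂ ≠ q₁) (h22 : p₂ ≠ q₂)
    (hop₁ : o ≠ p₁) (hop₂ : o ≠ p₂) (hoq₁ : o ≠ q₁) (hoq₂ : o ≠ q₂) (hjo : j ≠ o) (hbo : b ≠ o)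
    (hisoK : ∀ u' : Fin n, u' ≠ o → K s(o, u') = 0)
    (G : Finset (Fin n) → ℝ)
    (hG : ∀ T : Finset (Fin n), G T =
      (prodBernoulli (fun f : Sym2 (Fin n) => if f ∈ T.image (fun t => s(o, t)) then 1 else K f)).real (openConn o b) -
        (prodBernoulli (fun f : Sym2 (Fin n) => if f ∈ T.image (fun t => s(o, t)) then 1 else K f)).real (openConn j b))
    (hrow : 0 ≤ (1 - (u : ℝ)) * (1 - (v : ℝ)) * ((prodBernoulli K).real (openConn q₁ b) - (prodBernoulli K).real (openConn j b)) +
      (u : ℝ) * (1 - (v : ℝ)) * ((prodBernoulli (fun f : Sym2 (Fin n) => if f = s(p₁, p₂) then 1 else K f)).real (openConn q₁ b) -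
        (prodBernoulli (fun f : Sym2 (Fin n) => if f = s(p₁, p₂) then 1 else K f)).real (openConn j b)) +
      (1 - (u : ℝ)) * (v : ℝ) * ((prodBernoulli (fun f : Sym2 (Fin n) => if f = s(q₁, q₂) then 1 else K f)).real (openConn q₁ b) -
        (prodBernoulli (fun f : Sym2 (Fin n) => if f = s(q₁, q₂) then 1 else K f)).real (openConn j b)) +
      (u : ℝ) * (v : ℝ) * ((prodBernoulli (fun f : Sym2 (Fin n) => if f = s(p₁, p₂) then 1 else if f = s(q₁, q₂) then 1 else K f)).real (openConn q₁ b) -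
        (prodBernoulli (fun f : Sym2 (Fin n) => if f = s(p₁, p₂) then 1 else if f = s(q₁, q₂) then 1 else K f)).real (openConn j b))) :
    0 ≤ (1 - (u : ℝ)) * ((1 - (v : ℝ)) * G {q₁} + (v : ℝ) * G {q₂, q₁}) +
      (u : ℝ) * ((1 - (v : ℝ)) * G {q₁, p₁, p₂} + (v : ℝ) * G {q₂, q₁, p₁, p₂}) := by
  set eP : Sym2 (Fin n) := s(p₁, p₂) with heP
  set eQ : Sym2 (Fin n) := s(q₁, q₂) with heQ
  set P : Finset (Fin n) := {p₁, p₂} with hPdef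
  have hPQne : eP ≠ eQ := by
    rw [heP, heQ]; intro h
    rcases Sym2.eq_iff.1 h with ⟨h1, _⟩ | ⟨h1, _⟩
    · exact h11 h1
    · exact h12 h1
  set Kv : Sym2 (Fin n) → unitInterval := fun f => if f = eQ then Set.Icc.convexComb (K eQ) 1 v else K f with hKv
  have hq₁P : q₁ ∉ P := by rw [hPdef]; simp [h11.symm, h21.symm]
  have hp₁P : p₁ ∈ P := by rw [hPdef]; simp
  -- the clique of `P` is the pair update, and `eQ` is not a clique pair of `P` nor of `insert q₁ P`
  have hglueP : ∀ g : Sym2 (Fin n) → unitInterval,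
      (fun f : Sym2 (Fin n) => if (∀ x ∈ f, x ∈ P) ∧ ¬ f.IsDiag then (1 : unitInterval) else g f) = fun f => if f = eP then 1 else g f :=
    fun g => glue_pair_eq g hp
  have heQP : ¬ ((∀ x ∈ eQ, x ∈ P) ∧ ¬ eQ.IsDiag) := by
    rintro ⟨h, -⟩; exact hq₁P (h q₁ (by rw [heQ]; exact Sym2.mem_mk_left _ _))
  -- hypothesis of `twoAtomGlue` with base `Kv`
  have hsplit0 : ∀ z, (prodBernoulli Kv).real (openConn z b) =
      (1 - (v : ℝ)) * (prodBernoulli K).real (openConn z b) +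
        (v : ℝ) * (prodBernoulli (fun f : Sym2 (Fin n) => if f = eQ then 1 else K f)).real (openConn z b) :=
    fun z => real_raisePair_eq_mix K eQ v (openConn z b)
  set KPf : Sym2 (Fin n) → unitInterval := fun f => if f = eP then 1 else K f with hKPf
  set KPQf : Sym2 (Fin n) → unitInterval := fun f => if f = eP then 1 else if f = eQ then 1 else K f with hKPQf
  have hsplitP : ∀ z, (prodBernoulli (fun f : Sym2 (Fin n) => if (∀ x ∈ f, x ∈ P) ∧ ¬ f.IsDiag then 1 else Kv f)).real (openConn z b) =
      (1 - (v : ℝ)) * (prodBernoulli KPf).real (openConn z b) + (v : ℝ) * (prodBernoulli KPQf).real (openConn z b) := by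
    intro z
    have e1 : (fun f : Sym2 (Fin n) => if (∀ x ∈ f, x ∈ P) ∧ ¬ f.IsDiag then (1 : unitInterval) else Kv f) =
        fun f => if f = eQ then Set.Icc.convexComb (KPf eQ) 1 v else KPf f := by
      rw [hglueP Kv]; funext f
      by_cases hf : f = eQ
      · rw [if_pos hf, hf, if_neg hPQne.symm]
        simp only [hKv, hKPf, if_true, if_neg hPQne.symm]
      · rw [if_neg hf]
        by_cases hf2 : f = eP
        · rw [if_pos hf2]; simp only [hKPf, if_pos hf2]
        · rw [if_neg hf2]; simp only [hKv, hKPf, if_neg hf, if_neg hf2]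
    have e2 : (fun f : Sym2 (Fin n) => if f = eQ then (1 : unitInterval) else KPf f) = KPQf := by
      funext f
      by_cases h1 : f = eQ
      · rw [if_pos h1]; simp only [hKPQf, h1, if_neg hPQne.symm, if_true]
      · rw [if_neg h1]; simp only [hKPf, hKPQf, if_neg h1]
    rw [e1, real_raisePair_eq_mix, e2]
  have hyp' : 0 ≤ (1 - (u : ℝ)) * ((prodBernoulli Kv).real (openConn q₁ b) - (prodBernoulli Kv).real (openConn j b)) +
      (u : ℝ) * ((prodBernoulli (fun f : Sym2 (Fin n) => if (∀ x ∈ f, x ∈ P) ∧ ¬ f.IsDiag then 1 else Kv f)).real (openConn q₁ b) -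
        (prodBernoulli (fun f : Sym2 (Fin n) => if (∀ x ∈ f, x ∈ P) ∧ ¬ f.IsDiag then 1 else Kv f)).real (openConn j b)) := by
    rw [hsplit0, hsplit0, hsplitP, hsplitP]
    nlinarith [hrow]
  have key := twoAtomGlue Kv P q₁ j b p₁ hp₁P hq₁P (u.2.1) (u.2.2) hyp'
  -- convert the conclusion
  set eM : Sym2 (Fin n) := s(q₁, p₁) with heM
  have heMQ : eM ≠ eQ := by
    rw [heM, heQ]; intro h
    rcases Sym2.eq_iff.1 h with ⟨_, h2⟩ | ⟨h1, _⟩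
    · exact h12 h2
    · exact hq h1
  set gM : Sym2 (Fin n) → unitInterval := fun f => if f ∈ ({eM, eP} : Finset (Sym2 (Fin n))) then 1 else K f with hgM
  set gMQ : Sym2 (Fin n) → unitInterval := fun f => if f ∈ ({eQ, eM, eP} : Finset (Sym2 (Fin n))) then 1 else K f with hgMQ
  have hsplitM : ∀ z, (prodBernoulli (fun f : Sym2 (Fin n) => if f = eM then 1 else
        (if (∀ x ∈ f, x ∈ P) ∧ ¬ f.IsDiag then 1 else Kv f))).real (openConn z b) =
      (1 - (v : ℝ)) * (prodBernoulli gM).real (openConn z b) + (v : ℝ) * (prodBernoulli gMQ).real (openConn z b) := by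
    intro z
    have e3 : (fun f : Sym2 (Fin n) => if f = eM then (1 : unitInterval) else (if (∀ x ∈ f, x ∈ P) ∧ ¬ f.IsDiag then 1 else Kv f)) =
        fun f => if f = eQ then Set.Icc.convexComb (gM eQ) 1 v else gM f := by
      funext f
      have hcl : (if (∀ x ∈ f, x ∈ P) ∧ ¬ f.IsDiag then (1 : unitInterval) else Kv f) = if f = eP then 1 else Kv f :=
        congrFun (hglueP Kv) f
      rw [hcl]
      have hgMeQ : gM eQ = K eQ := by
        simp only [hgM, Finset.mem_insert, Finset.mem_singleton, heMQ.symm, hPQne.symm]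
        simp
      by_cases h1 : f = eM
      · rw [if_pos h1, h1, if_neg heMQ]; simp [hgM]
      · rw [if_neg h1]
        by_cases h2 : f = eP
        · rw [if_pos h2, h2, if_neg hPQne]; simp [hgM]
        · rw [if_neg h2]
          by_cases h3 : f = eQ
          · rw [if_pos h3, h3, hgMeQ]; simp only [hKv, if_true]
          · rw [if_neg h3]; simp [hKv, hgM, h1, h2, h3]
    have e4 : (fun f : Sym2 (Fin n) => if f = eQ then (1 : unitInterval) else gM f) = gMQ := by
      funext f; simp only [hgM, hgMQ, Finset.mem_insert, Finset.mem_singleton]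
      by_cases h3 : f = eQ
      · simp [h3]
      · simp [h3]
    rw [e3, real_raisePair_eq_mix, e4]
  -- forced-star evaluations
  have hG1 : G {q₁} = (prodBernoulli K).real (openConn q₁ b) - (prodBernoulli K).real (openConn j b) := by
    have h := forcedMargin_eq K o b j hisoK hbo hjo {q₁} (by simp [hoq₁]) q₁ (by simp) ∅ (by simp) (by simp)
    rw [hG, h]; simp
  have hG2 : G {q₂, q₁} = (prodBernoulli (fun f : Sym2 (Fin n) => if f = eQ then 1 else K f)).real (openConn q₁ b) -
      (prodBernoulli (fun f : Sym2 (Fin n) => if f = eQ then 1 else K f)).real (openConn j b) := by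
    have h := forcedMargin_eq K o b j hisoK hbo hjo {q₂, q₁} (by simp [hoq₁, hoq₂]) q₁ (by simp) {eQ}
      (by intro e he x hx; rw [Finset.mem_singleton] at he; subst he; rw [heQ] at hx
          rcases Sym2.mem_iff.1 hx with rfl | rfl <;> simp)
      (by intro t ht; simp only [Finset.mem_insert, Finset.mem_singleton] at ht
          rcases ht with rfl | rfl
          · exact Or.inr (Or.inl (by rw [heQ]; simp))
          · exact Or.inl rfl)
    rw [hG, h]; simp
  have hG3 : G {q₁, p₁, p₂} = (prodBernoulli gM).real (openConn q₁ b) - (prodBernoulli gM).real (openConn j b) := by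
    have h := forcedMargin_eq K o b j hisoK hbo hjo {q₁, p₁, p₂} (by simp [hoq₁, hop₁, hop₂]) q₁ (by simp) {eM, eP}
      (by intro e he x hx; simp only [Finset.mem_insert, Finset.mem_singleton] at he
          rcases he with rfl | rfl
          · rw [heM] at hx; rcases Sym2.mem_iff.1 hx with rfl | rfl <;> simp
          · rw [heP] at hx; rcases Sym2.mem_iff.1 hx with rfl | rfl <;> simp)
      (by intro t ht; simp only [Finset.mem_insert, Finset.mem_singleton] at ht
          rcases ht with rfl | rfl | rfl
          · exact Or.inl rfl
          · exact Or.inr (Or.inl (by rw [heM]; simp))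
          · exact Or.inr (Or.inr ⟨p₁, h11, hp, by rw [heM, Sym2.eq_swap]; simp, by rw [heP]; simp⟩))
    rw [hG, h]
  have hG4 : G {q₂, q₁, p₁, p₂} = (prodBernoulli gMQ).real (openConn q₁ b) - (prodBernoulli gMQ).real (openConn j b) := by
    have h := forcedMargin_eq K o b j hisoK hbo hjo {q₂, q₁, p₁, p₂} (by simp [hoq₁, hoq₂, hop₁, hop₂]) q₁ (by simp) {eQ, eM, eP}
      (by intro e he x hx; simp only [Finset.mem_insert, Finset.mem_singleton] at he
          rcases he with rfl | rfl | rfl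
          · rw [heQ] at hx; rcases Sym2.mem_iff.1 hx with rfl | rfl <;> simp
          · rw [heM] at hx; rcases Sym2.mem_iff.1 hx with rfl | rfl <;> simp
          · rw [heP] at hx; rcases Sym2.mem_iff.1 hx with rfl | rfl <;> simp)
      (by intro t ht; simp only [Finset.mem_insert, Finset.mem_singleton] at ht
          rcases ht with rfl | rfl | rfl | rfl
          · exact Or.inr (Or.inl (by rw [heQ]; simp))
          · exact Or.inl rfl
          · exact Or.inr (Or.inl (by rw [heM]; simp))
          · exact Or.inr (Or.inr ⟨p₁, h11, hp, by rw [heM, Sym2.eq_swap]; simp, by rw [heP]; simp⟩))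
    rw [hG, h]
  rw [hG1, hG2, hG3, hG4]
  rw [hsplit0, hsplit0, hsplitM, hsplitM] at key
  nlinarith [key]

/-- **The FORMAL×FORMAL corner.**  See the module docstring. [cite: KozmaNitzan2024, Lemma 5, Lemma 3(i), Question 9 (pp. 6, 13, 36)] -/
theorem ffCorner (K : Sym2 (Fin n) → unitInterval) (o p₁ p₂ q₁ q₂ j b : Fin n) (u v : unitInterval)
    (hp : p₁ ≠ p₂) (hq : q₁ ≠ q₂) (h11 : p₁ ≠ q₁) (h12 : p₁ ≠ q₂) (h21 : p₂ ≠ q₁) (h22 : p₂ ≠ q₂)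
    (hop₁ : o ≠ p₁) (hop₂ : o ≠ p₂) (hoq₁ : o ≠ q₁) (hoq₂ : o ≠ q₂) (hjo : j ≠ o) (hbo : b ≠ o)
    (hisoK : ∀ u' : Fin n, u' ≠ o → K s(o, u') = 0)
    (G : Finset (Fin n) → ℝ)
    (hG : ∀ T : Finset (Fin n), G T =
      (prodBernoulli (fun f : Sym2 (Fin n) => if f ∈ T.image (fun t => s(o, t)) then 1 else K f)).real (openConn o b) -
        (prodBernoulli (fun f : Sym2 (Fin n) => if f ∈ T.image (fun t => s(o, t)) then 1 else K f)).real (openConn j b))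
    (hrow : ∀ z ∈ ({p₁, p₂, q₁, q₂} : Finset (Fin n)), 0 ≤
      (1 - (u : ℝ)) * (1 - (v : ℝ)) * ((prodBernoulli K).real (openConn z b) - (prodBernoulli K).real (openConn j b)) +
      (u : ℝ) * (1 - (v : ℝ)) * ((prodBernoulli (fun f : Sym2 (Fin n) => if f = s(p₁, p₂) then 1 else K f)).real (openConn z b) -
        (prodBernoulli (fun f : Sym2 (Fin n) => if f = s(p₁, p₂) then 1 else K f)).real (openConn j b)) +
      (1 - (u : ℝ)) * (v : ℝ) * ((prodBernoulli (fun f : Sym2 (Fin n) => if f = s(q₁, q₂) then 1 else K f)).real (openConn z b) -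
        (prodBernoulli (fun f : Sym2 (Fin n) => if f = s(q₁, q₂) then 1 else K f)).real (openConn j b)) +
      (u : ℝ) * (v : ℝ) * ((prodBernoulli (fun f : Sym2 (Fin n) => if f = s(p₁, p₂) then 1 else if f = s(q₁, q₂) then 1 else K f)).real (openConn z b) -
        (prodBernoulli (fun f : Sym2 (Fin n) => if f = s(p₁, p₂) then 1 else if f = s(q₁, q₂) then 1 else K f)).real (openConn j b))) :
    0 ≤ (u : ℝ) * (1 - (v : ℝ)) * G {p₁, p₂} + (1 - (u : ℝ)) * (v : ℝ) * G {q₁, q₂} + (u : ℝ) * (v : ℝ) * G {q₂, q₁, p₁, p₂} := by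
  set eP : Sym2 (Fin n) := s(p₁, p₂) with heP
  set eQ : Sym2 (Fin n) := s(q₁, q₂) with heQ
  set eM : Sym2 (Fin n) := s(q₁, p₁) with heM
  have hPQne : eP ≠ eQ := by
    rw [heP, heQ]; intro h
    rcases Sym2.eq_iff.1 h with ⟨h1, _⟩ | ⟨h1, _⟩
    · exact h11 h1
    · exact h12 h1
  have heMQ : eM ≠ eQ := by
    rw [heM, heQ]; intro h
    rcases Sym2.eq_iff.1 h with ⟨_, h2⟩ | ⟨h1, _⟩
    · exact h12 h2
    · exact hq h1
  have heMP : eM ≠ eP := by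
    rw [heM, heP]; intro h
    rcases Sym2.eq_iff.1 h with ⟨h1, _⟩ | ⟨h1, _⟩
    · exact h11 h1.symm
    · exact h21 h1.symm
  set KP : Sym2 (Fin n) → unitInterval := fun f => if f = eP then 1 else K f with hKP
  set KQ : Sym2 (Fin n) → unitInterval := fun f => if f = eQ then 1 else K f with hKQ
  set KPQ : Sym2 (Fin n) → unitInterval := fun f => if f = eP then 1 else if f = eQ then 1 else K f with hKPQ
  set wM : Sym2 (Fin n) → unitInterval := fun f => if f = eM then 1 else KPQ f with hwM
  -- (1) the far-end rows from the rows of p₁ and q₁: Lemma 5 for one pair in the doubly raised base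
  set Kv : Sym2 (Fin n) → unitInterval := fun f => if f = eQ then Set.Icc.convexComb (K eQ) 1 v else K f with hKv
  set Kuv : Sym2 (Fin n) → unitInterval := fun f => if f = eP then Set.Icc.convexComb (Kv eP) 1 u else Kv f with hKuv
  have hKv_split : ∀ z, (prodBernoulli Kv).real (openConn z b) =
      (1 - (v : ℝ)) * (prodBernoulli K).real (openConn z b) + (v : ℝ) * (prodBernoulli KQ).real (openConn z b) :=
    fun z => real_raisePair_eq_mix K eQ v (openConn z b)
  have hKvP : (fun f : Sym2 (Fin n) => if f = eP then (1 : unitInterval) else Kv f) =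
      fun f => if f = eQ then Set.Icc.convexComb (KP eQ) 1 v else KP f := by
    funext f
    by_cases h1 : f = eP
    · rw [if_pos h1, h1, if_neg hPQne]; simp only [hKP, if_true]
    · rw [if_neg h1]
      by_cases h2 : f = eQ
      · rw [if_pos h2, h2]; simp only [hKv, hKP, if_true, if_neg hPQne.symm]
      · rw [if_neg h2]; simp only [hKv, hKP, if_neg h2, if_neg h1]
  have hKPQ' : (fun f : Sym2 (Fin n) => if f = eQ then (1 : unitInterval) else KP f) = KPQ := by
    funext f
    by_cases h2 : f = eQ
    · rw [if_pos h2]; simp only [hKPQ, h2, if_neg hPQne.symm, if_true]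
    · rw [if_neg h2]; simp only [hKP, hKPQ, if_neg h2]
  have hKvP_split : ∀ z, (prodBernoulli (fun f : Sym2 (Fin n) => if f = eP then 1 else Kv f)).real (openConn z b) =
      (1 - (v : ℝ)) * (prodBernoulli KP).real (openConn z b) + (v : ℝ) * (prodBernoulli KPQ).real (openConn z b) := by
    intro z; rw [hKvP, real_raisePair_eq_mix, hKPQ']
  have hKuv_split : ∀ z, (prodBernoulli Kuv).real (openConn z b) =
      (1 - (u : ℝ)) * (prodBernoulli Kv).real (openConn z b) +
        (u : ℝ) * (prodBernoulli (fun f : Sym2 (Fin n) => if f = eP then 1 else Kv f)).real (openConn z b) :=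
    fun z => real_raisePair_eq_mix Kv eP u (openConn z b)
  have hr1 := hrow p₁ (by simp)
  have hr3 := hrow q₁ (by simp)
  have hle1 : (prodBernoulli Kuv).real (openConn j b) ≤ (prodBernoulli Kuv).real (openConn p₁ b) := by
    rw [hKuv_split, hKuv_split, hKv_split, hKv_split, hKvP_split, hKvP_split]; nlinarith [hr1]
  have hle3 : (prodBernoulli Kuv).real (openConn j b) ≤ (prodBernoulli Kuv).real (openConn q₁ b) := by
    rw [hKuv_split, hKuv_split, hKv_split, hKv_split, hKvP_split, hKvP_split]; nlinarith [hr3]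
  -- M_P: glue the pair eP
  have gl1 := pairGlue_le Kuv hp j b hle1
  have hKuvP : (fun f : Sym2 (Fin n) => if f = s(p₁, p₂) then (1 : unitInterval) else Kuv f) =
      fun f => if f = eQ then Set.Icc.convexComb (KP eQ) 1 v else KP f := by
    rw [← hKvP]; funext f
    by_cases h1 : f = eP
    · rw [← heP, if_pos h1, if_pos h1]
    · rw [← heP, if_neg h1, if_neg h1]; simp only [hKuv, if_neg h1]
  have hMP : 0 ≤ (1 - (v : ℝ)) * ((prodBernoulli KP).real (openConn p₁ b) - (prodBernoulli KP).real (openConn j b)) +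
      (v : ℝ) * ((prodBernoulli KPQ).real (openConn p₁ b) - (prodBernoulli KPQ).real (openConn j b)) := by
    rw [hKuvP, real_raisePair_eq_mix, real_raisePair_eq_mix, hKPQ'] at gl1
    nlinarith [gl1]
  -- M_Q: glue the pair eQ
  have gl3 := pairGlue_le Kuv hq j b hle3
  have hKuvQ : (fun f : Sym2 (Fin n) => if f = s(q₁, q₂) then (1 : unitInterval) else Kuv f) =
      fun f => if f = eP then Set.Icc.convexComb (KQ eP) 1 u else KQ f := by
    funext f
    rw [← heQ]
    by_cases h2 : f = eQ
    · rw [if_pos h2, h2, if_neg hPQne.symm]; simp only [hKQ, if_true]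
    · rw [if_neg h2]
      by_cases h1 : f = eP
      · rw [if_pos h1, h1]; simp only [hKuv, hKv, hKQ, if_true, if_neg hPQne]
      · rw [if_neg h1]; simp only [hKuv, hKv, hKQ, if_neg h1, if_neg h2]
  have hKQP : (fun f : Sym2 (Fin n) => if f = eP then (1 : unitInterval) else KQ f) = KPQ := by
    funext f
    by_cases h1 : f = eP
    · rw [if_pos h1]; simp only [hKPQ, if_pos h1]
    · rw [if_neg h1]; simp only [hKQ, hKPQ, if_neg h1]
  have hMQ : 0 ≤ (1 - (u : ℝ)) * ((prodBernoulli KQ).real (openConn q₁ b) - (prodBernoulli KQ).real (openConn j b)) +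
      (u : ℝ) * ((prodBernoulli KPQ).real (openConn q₁ b) - (prodBernoulli KPQ).real (openConn j b)) := by
    rw [hKuvQ, real_raisePair_eq_mix, real_raisePair_eq_mix, hKQP] at gl3
    nlinarith [gl3]
  -- (2) the unconditional two-formal-units inequality
  have key := twoFormalUnits K p₁ p₂ q₁ q₂ j b hp hq h11 u.2.1 u.2.2 v.2.1 v.2.2 hMP hMQ hrow
  -- (3) forced-star evaluations
  have hG1 : G {p₁, p₂} = (prodBernoulli KP).real (openConn p₁ b) - (prodBernoulli KP).real (openConn j b) := by
    have h := forcedMargin_eq K o b j hisoK hbo hjo {p₁, p₂} (by simp [hop₁, hop₂]) p₁ (by simp) {eP}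
      (by intro e he x hx; rw [Finset.mem_singleton] at he; subst he; rw [heP] at hx
          rcases Sym2.mem_iff.1 hx with rfl | rfl <;> simp)
      (by intro t ht; simp only [Finset.mem_insert, Finset.mem_singleton] at ht
          rcases ht with rfl | rfl
          · exact Or.inl rfl
          · exact Or.inr (Or.inl (by rw [heP]; simp)))
    rw [hG, h]; simp [hKP]
  have hG2 : G {q₁, q₂} = (prodBernoulli KQ).real (openConn q₁ b) - (prodBernoulli KQ).real (openConn j b) := by
    have h := forcedMargin_eq K o b j hisoK hbo hjo {q₁, q₂} (by simp [hoq₁, hoq₂]) q₁ (by simp) {eQ}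
      (by intro e he x hx; rw [Finset.mem_singleton] at he; subst he; rw [heQ] at hx
          rcases Sym2.mem_iff.1 hx with rfl | rfl <;> simp)
      (by intro t ht; simp only [Finset.mem_insert, Finset.mem_singleton] at ht
          rcases ht with rfl | rfl
          · exact Or.inl rfl
          · exact Or.inr (Or.inl (by rw [heQ]; simp)))
    rw [hG, h]; simp [hKQ]
  have hG4 : G {q₂, q₁, p₁, p₂} = (prodBernoulli wM).real (openConn p₁ b) - (prodBernoulli wM).real (openConn j b) := by
    have h := forcedMargin_eq K o b j hisoK hbo hjo {q₂, q₁, p₁, p₂} (by simp [hoq₁, hoq₂, hop₁, hop₂]) p₁ (by simp) {eM, eP, eQ}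
      (by intro e he x hx; simp only [Finset.mem_insert, Finset.mem_singleton] at he
          rcases he with rfl | rfl | rfl
          · rw [heM] at hx; rcases Sym2.mem_iff.1 hx with rfl | rfl <;> simp
          · rw [heP] at hx; rcases Sym2.mem_iff.1 hx with rfl | rfl <;> simp
          · rw [heQ] at hx; rcases Sym2.mem_iff.1 hx with rfl | rfl <;> simp)
      (by intro t ht; simp only [Finset.mem_insert, Finset.mem_singleton] at ht
          rcases ht with rfl | rfl | rfl | rfl
          · exact Or.inr (Or.inr ⟨q₁, h11.symm, hq, by rw [heM]; simp, by rw [heQ]; simp⟩)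
          · exact Or.inr (Or.inl (by rw [heM, Sym2.eq_swap]; simp))
          · exact Or.inl rfl
          · exact Or.inr (Or.inl (by rw [heP]; simp)))
    have hwM' : (fun f : Sym2 (Fin n) => if f ∈ ({eM, eP, eQ} : Finset (Sym2 (Fin n))) then (1 : unitInterval) else K f) = wM := by
      funext f
      simp only [hwM, hKPQ, Finset.mem_insert, Finset.mem_singleton]
      by_cases h1 : f = eM
      · simp [h1]
      · by_cases h2 : f = eP
        · simp [h2, heMP.symm]
        · by_cases h3 : f = eQ
          · simp [h3, heMQ.symm, hPQne.symm]
          · simp [h1, h2, h3]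
    rw [hG, h, hwM']
  rw [hG1, hG2, hG4]
  exact key

end UpsetExchange

end

end Summit.CriticalPhenomena.PercolationContinuityZ3.Theorems
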